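import Literature.AnabelianGeometry.EtaleTheta.Discharge.Sec3Prop34iPhiZero
import HarnessLib

/-!
# [EtTh] Prop. 3.4 (i) for PRODUCTS of the constructed `Φ₀`-pieces with value monoids `≅ ℤ≥0` — the `hpf`
# input of Def. 3.6 (i) (`RealifiedDivisorMonoids.ofRlfZWeak`) for the arithmetic theta tower (GAP A, row D3)

Mochizuki, *The étale theta function and its Frobenioid-theoretic manifestations*, Publ. RIMS **45** (2009), §3:
Def. 3.3 (iii) PDF p. 73 (`Φ₀`), Prop. 3.4 (i) p. 74 ("`Φ₀(Y^log)` … is perf-factorial"; proof: "follows immediately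
from Proposition 3.2, (i)"), Def. 3.6 (i) p. 76 (`Φ₀^ℝ := Φ₀^rlf`) [cite: MochizukiEtTh2009, Prop 3.4 p.74];
Mochizuki, *The geometry of Frobenioids I*, Kyushu J. Math. **62** (2008), §0 p. 12 and Def. 2.4 (i) p. 47
(perf-factorial monoids, `M^pf`, `M^rlf`) [cite: MochizukiFrdI2008, Def. 2.4(i) p.47]; *Frobenioids II*, Ex. 1.1 (i)
p. 7 (`ord(𝒪^▷_K) ≅ ℤ≥0` for a `p`-adic local field) [cite: MochizukiFrdII2008, Ex 1.1 (i) p.7].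

abc-iut cell, GAP A (foundations gap G-L5-EX32I-1 around [IUTchI] Ex. 3.2 (i)(ii)(iii)), item **GA-03** (memo
GAP-SIZING-A row D3; ruled shape `plan/L5/GAP-A-SIGNATURES.md` v1 §3), seat abc-iut-gapA-03-realified.  The ruled
divisor monoid of the arithmetic theta tower (GA-02, RULINGS #334: `ArithThetaTower.divisorMonoidsOf d T A hZ`) has
`Φ₀(U) = A.phiZero (P ⧸ U) × ord(𝒪^▷_{Ω^{aug U}})` — the DIRECT SUM of a constructed Def. 3.3 (iii) piece
`Hom_P(P/U, Div⁺(Z^log_∞))` (abc-iut-w6-d058) and the genuine value monoid of the `p`-adic local field `Ω^{aug U}`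
([FrdII] Ex. 1.1 (i), `ℤ`-monoprime by `PadicFld.IsPadicLocal.isZMonoprime_ordInt`).  Def. 3.6 (i)
(`RealifiedDivisorMonoids.ofRlfZWeak dm hpf`, `RealifiedDivisorMonoidsOfRlfWeak.lean`) needs
`hpf : ∀ Y, IsPerfFactorialCof (Φ₀ Y)` (Prop. 3.4 (i) in the cell's repaired reading, F-L2d2-1/F-L2d2-2).  The tree
proves this for each factor (`LogDivisorModel.GaloisAction.isPerfFactorialCof_phiZero`; `ℤ≥0 ≅ ∏_{pt} ℤ≥0`) but has
NO product lemma for `IsPerfFactorialCof` (only `DirectSum.isPerfFactorial` / `PiMonoprime…` for MONOPRIME factors).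

THIS PROOF-ONLY FILE (theorems only, no definitions) supplies it for the class of monoids that is actually at hand —
monoids `M` admitting a **chart**: an injective homomorphism `φ : M → ∏_J ℤ≥0` whose image is GROUP-SATURATED and
PERF-DENSE ([EtTh] §0 p. 8; exactly the relation `Div⁺ ⊆ DIV⁺ ≅ ∏ ℤ≥0` of Prop. 3.2 (i), and the shape of every
`Div⁺(Z^log_∞)^{Gal}` by Rmk. 3.3.1).  Written out (no new definition is introduced) the chart hypothesis reads
`∃ (J : Type u) (φ : M →* Multiplicative (J → ℕ)), Injective φ ∧ IsGroupSaturated (mrange φ) ∧ ∀ x, x ∈ perfSaturation (mrange φ)`.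

* `IsPerfFactorialCof.of_exists_piNatChart` — a monoid with a chart is weakly perf-factorial with cofinal perfection
  (engines `GroupSaturatedSubmonoid.isPerfFactorialWeak` / `.rlfCofinal`, p432632, at `P = ∏_J ℤ≥0`,
  `PiNat.isPerfFactorialWeak'` / `PiNat.rlf_cofinal'`), with `ℤ`-monoprime prime components
  (`isZMonoprime_submonoid_primes_of_exists_piNatChart`);
* `exists_piNatChart_prod` — **charts multiply**: `(φ, ψ) : M × N → ∏_J ℤ≥0 × ∏_{J'} ℤ≥0 = ∏_{J ⊔ J'} ℤ≥0` is again
  a chart (group-saturation and perf-density are checked coordinate-block-wise); hence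
  `IsPerfFactorialCof.prod_of_exists_piNatChart`;
* `exists_piNatChart_of_mulEquiv` / `_of_submonoid` / `_of_mulEquiv_piNat` / `_of_isZMonoprime` — charts transport
  along isomorphisms, restrict to group-saturated perf-dense submonoids, and exist for `∏_J ℤ≥0` itself and for every
  `ℤ`-monoprime monoid;
* `LogDivisorModel.GaloisAction.exists_piNatChart_phiZero` — the constructed pieces `Φ₀(S) = Hom_G(S, Div⁺(Z^log_∞))`
  have charts (abc-iut-w6-d057's route: Cartier `Γ`-invariant maps ⊆ `Maps(S, DIV⁺)^Γ ≅ (∏ ℤ≥0)^{Γ₀} ≅ ∏_{orbits} ℤ≥0`);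
* **`LogDivisorModel.GaloisAction.isPerfFactorialCof_phiZero_prod`** — `Φ₀(S) × N` is weakly perf-factorial with
  cofinal perfection for every `ℤ`-monoprime `N`: the `hpf` input of GA-03's `ArithThetaTower.realified` at every
  object `U` of `CosetCat P` (also the symmetric and the `Φ₀(S) × Φ₀(S')` forms).

HONEST FRAMING: classical monoid algebra over the tree's typed [FrdI]/[EtTh] vocabulary; "perf-factorial" is READ in
the cell's weak vocabulary of record (`IsPerfFactorialCof`; the printed [FrdI] Def. 2.4 (i)(d) fails at `∏_ℕ ℤ≥0`,
F-L2d2-1); `LogDivisorModel` / `GaloisAction` are interface records — nothing asserts they arise from an actual curve;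
an UNDISPUTED construction step around [IUTchIII] Cor. 3.12, on which NO side is taken (D-0045); nothing here asserts
the abc conjecture proved or refuted; typed ≠ inhabited ≠ proved-in-print.
-/

noncomputable section

namespace Literature.AnabelianGeometry.EtaleTheta

open Literature.AlgebraicGeometry.Frobenioids Function

universe u

/-! ### Group-saturated, perf-dense submonoids of `∏_J ℤ≥0` -/

section PiNatSubmonoid

variable {J : Type u} {S : Submonoid (Multiplicative (J → ℕ))}

/-- **A group-saturated, perf-dense submonoid of `∏_J ℤ≥0` is weakly perf-factorial with cofinal perfection** (the
abstract form of "[Prop. 3.4 (i)] follows immediately from Proposition 3.2, (i)": engine `GroupSaturatedSubmonoid` at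
`P = ∏_J ℤ≥0`). [cite: MochizukiEtTh2009, Prop 3.4 p.74] -/
theorem isPerfFactorialCof_of_isGroupSaturated_piNat (hsat : IsGroupSaturated S)
    (hdense : ∀ x, x ∈ perfSaturation S) : IsPerfFactorialCof ↥S :=
  have hP : IsPerfFactorialWeak (Multiplicative (J → ℕ)) := PiNat.isPerfFactorialWeak'
  have hS : IsPerfFactorialWeak ↥S :=
    GroupSaturatedSubmonoid.isPerfFactorialWeak hP PiNat.isZMonoprime_submonoid_prime hsat hdense
  ⟨hS, GroupSaturatedSubmonoid.rlfCofinal hP PiNat.rlf_cofinal' hdense hS⟩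

/-- … and every prime component of such a submonoid is `ℤ`-monoprime (`≅ ℤ≥0`; Rmk. 3.3.1: primes = orbits of prime
log-divisors). [cite: MochizukiEtTh2009, Rmk 3.3.1 p.73] -/
theorem isZMonoprime_submonoid_primes_of_isGroupSaturated_piNat (hsat : IsGroupSaturated S)
    (hdense : ∀ x, x ∈ perfSaturation S) (𝔭 : Primes ↥S) : IsZMonoprime ↥𝔭.submonoid :=
  GroupSaturatedSubmonoid.isZMonoprime_submonoid_primes
    (PiNat.isPerfFactorialWeak' (J := J)).isDivisorial.isSharp PiNat.isZMonoprime_submonoid_prime hsat hdense 𝔭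

end PiNatSubmonoid

/-! ### Charts `M ↪ ∏_J ℤ≥0` with group-saturated, perf-dense image -/

section Charts

variable {M : Type u} [CommMonoid M] {M' : Type u} [CommMonoid M'] {N : Type u} [CommMonoid N]

/-- **A monoid with a chart is weakly perf-factorial with cofinal perfection** (transport along `M ≅ φ(M)`).
[cite: MochizukiFrdI2008, Def. 2.4(i) p.47] -/
theorem IsPerfFactorialCof.of_piNatChart {J : Type u} (φ : M →* Multiplicative (J → ℕ)) (hφ : Injective φ)
    (hsat : IsGroupSaturated (MonoidHom.mrange φ)) (hdense : ∀ x, x ∈ perfSaturation (MonoidHom.mrange φ)) :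
    IsPerfFactorialCof M := by
  have e : M ≃* ↥(MonoidHom.mrange φ) :=
    MulEquiv.ofBijective φ.mrangeRestrict
      ⟨fun a b h => hφ (congrArg Subtype.val h), φ.mrangeRestrict_surjective⟩
  obtain ⟨hw, hcof⟩ := isPerfFactorialCof_of_isGroupSaturated_piNat hsat hdense
  exact ⟨hw.of_mulEquiv e.symm, hw.rlfCofinal_of_mulEquiv e.symm hcof (hw.of_mulEquiv e.symm)⟩

/-- The prime components of a monoid with a chart are `ℤ`-monoprime. [cite: MochizukiEtTh2009, Rmk 3.3.1 p.73] -/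
theorem isZMonoprime_submonoid_primes_of_piNatChart {J : Type u} (φ : M →* Multiplicative (J → ℕ))
    (hφ : Injective φ) (hsat : IsGroupSaturated (MonoidHom.mrange φ))
    (hdense : ∀ x, x ∈ perfSaturation (MonoidHom.mrange φ)) (𝔭 : Primes M) : IsZMonoprime ↥𝔭.submonoid := by
  have e : M ≃* ↥(MonoidHom.mrange φ) :=
    MulEquiv.ofBijective φ.mrangeRestrict
      ⟨fun a b h => hφ (congrArg Subtype.val h), φ.mrangeRestrict_surjective⟩
  exact (isZMonoprime_submonoid_primes_of_isGroupSaturated_piNat hsat hdense (Primes.congr e 𝔭)).of_mulEquiv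
    (Primes.submonoidCongr e.symm (Primes.congr e 𝔭) 𝔭 (Primes.congr_symm_apply_congr e 𝔭))

/-- `∃`-form: a monoid with SOME chart is weakly perf-factorial with cofinal perfection.
[cite: MochizukiFrdI2008, Def. 2.4(i) p.47] -/
theorem IsPerfFactorialCof.of_exists_piNatChart
    (h : ∃ (J : Type u) (φ : M →* Multiplicative (J → ℕ)), Injective φ ∧
      IsGroupSaturated (MonoidHom.mrange φ) ∧ ∀ x, x ∈ perfSaturation (MonoidHom.mrange φ)) :
    IsPerfFactorialCof M := by
  obtain ⟨J, φ, hφ, hsat, hdense⟩ := h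
  exact IsPerfFactorialCof.of_piNatChart φ hφ hsat hdense

/-- `∃`-form: the prime components of a monoid with SOME chart are `ℤ`-monoprime. [cite: MochizukiEtTh2009, Rmk 3.3.1 p.73] -/
theorem isZMonoprime_submonoid_primes_of_exists_piNatChart
    (h : ∃ (J : Type u) (φ : M →* Multiplicative (J → ℕ)), Injective φ ∧
      IsGroupSaturated (MonoidHom.mrange φ) ∧ ∀ x, x ∈ perfSaturation (MonoidHom.mrange φ))
    (𝔭 : Primes M) : IsZMonoprime ↥𝔭.submonoid := by
  obtain ⟨J, φ, hφ, hsat, hdense⟩ := h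
  exact isZMonoprime_submonoid_primes_of_piNatChart φ hφ hsat hdense 𝔭

/-- **Charts transport along isomorphisms** `M ≅ M'` (precompose with `e⁻¹`; the image is unchanged).
[cite: MochizukiFrdI2008, Def. 2.4(i) p.47] -/
theorem exists_piNatChart_of_mulEquiv (e : M ≃* M')
    (h : ∃ (J : Type u) (φ : M →* Multiplicative (J → ℕ)), Injective φ ∧
      IsGroupSaturated (MonoidHom.mrange φ) ∧ ∀ x, x ∈ perfSaturation (MonoidHom.mrange φ)) :
    ∃ (J : Type u) (φ : M' →* Multiplicative (J → ℕ)), Injective φ ∧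
      IsGroupSaturated (MonoidHom.mrange φ) ∧ ∀ x, x ∈ perfSaturation (MonoidHom.mrange φ) := by
  obtain ⟨J, φ, hφ, hsat, hdense⟩ := h
  have hr : MonoidHom.mrange (φ.comp e.symm.toMonoidHom) = MonoidHom.mrange φ := by
    ext x
    constructor
    · rintro ⟨y, rfl⟩
      exact ⟨e.symm y, rfl⟩
    · rintro ⟨y, rfl⟩
      exact ⟨e y, by simp⟩
  refine ⟨J, φ.comp e.symm.toMonoidHom, hφ.comp e.symm.injective, ?_, ?_⟩
  · rw [hr]; exact hsat
  · rw [hr]; exact hdense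

/-- **A group-saturated, perf-dense submonoid `C` of a monoid `F ≅ ∏_Q ℤ≥0` has a chart** (the inclusion followed by
the isomorphism; its image `e(C)` is group-saturated and perf-dense because `e` is an isomorphism).
[cite: MochizukiEtTh2009, Prop 3.2 p.70] -/
theorem exists_piNatChart_of_submonoid {F : Type u} [CommMonoid F] {C : Submonoid F} {Q : Type u}
    (e : F ≃* Multiplicative (Q → ℕ)) (hsat : IsGroupSaturated C) (hdense : ∀ x : F, x ∈ perfSaturation C) :
    ∃ (J : Type u) (φ : ↥C →* Multiplicative (J → ℕ)), Injective φ ∧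
      IsGroupSaturated (MonoidHom.mrange φ) ∧ ∀ x, x ∈ perfSaturation (MonoidHom.mrange φ) := by
  have hr : ∀ y, y ∈ MonoidHom.mrange (e.toMonoidHom.comp C.subtype) ↔ e.symm y ∈ C := by
    intro y
    constructor
    · rintro ⟨c, rfl⟩
      simp
    · intro hy
      exact ⟨⟨e.symm y, hy⟩, by simp⟩
  refine ⟨Q, e.toMonoidHom.comp C.subtype, e.injective.comp Subtype.val_injective, ?_, fun y => ?_⟩
  · rw [isGroupSaturated_iff']
    intro q a ha b hb hqb
    rw [hr] at ha hb ⊢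
    exact (isGroupSaturated_iff' C).mp hsat (e.symm q) _ ha _ hb (by rw [← map_mul, hqb])
  · obtain ⟨n, hn⟩ := (mem_perfSaturation_iff C (e.symm y)).mp (hdense (e.symm y))
    exact (mem_perfSaturation_iff _ y).mpr ⟨n, (hr _).mpr (by rwa [map_pow])⟩

/-- **`∏_J ℤ≥0` itself (and anything isomorphic to it) has a chart**: the isomorphism, with image everything.
[cite: MochizukiEtTh2009, Prop 3.2 p.70] -/
theorem exists_piNatChart_of_mulEquiv_piNat {J : Type u} (e : M ≃* Multiplicative (J → ℕ)) :
    ∃ (J : Type u) (φ : M →* Multiplicative (J → ℕ)), Injective φ ∧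
      IsGroupSaturated (MonoidHom.mrange φ) ∧ ∀ x, x ∈ perfSaturation (MonoidHom.mrange φ) := by
  have htop : MonoidHom.mrange e.toMonoidHom = ⊤ := MonoidHom.mrange_eq_top.mpr e.surjective
  refine ⟨J, e.toMonoidHom, e.injective, ?_, fun x => ?_⟩
  · rw [htop, isGroupSaturated_iff']
    intro q _ _ _ _ _
    exact Submonoid.mem_top q
  · rw [htop]
    exact le_perfSaturation _ (Submonoid.mem_top x)

/-- **Every `ℤ`-monoprime monoid has a chart** (`N ≅ ℤ≥0 = ∏_{pt} ℤ≥0`) — e.g. the value monoid `ord(𝒪^▷_K)` of a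
`p`-adic local field ([FrdII] Ex. 1.1 (i); `PadicFld.IsPadicLocal.isZMonoprime_ordInt`).
[cite: MochizukiFrdII2008, Ex 1.1 (i) p.7] -/
theorem exists_piNatChart_of_isZMonoprime (hN : IsZMonoprime N) :
    ∃ (J : Type u) (φ : N →* Multiplicative (J → ℕ)), Injective φ ∧
      IsGroupSaturated (MonoidHom.mrange φ) ∧ ∀ x, x ∈ perfSaturation (MonoidHom.mrange φ) := by
  obtain ⟨⟨e⟩⟩ := hN
  -- `ℤ≥0 ≅ ∏_{pt} ℤ≥0`
  let u : Multiplicative ℕ ≃* Multiplicative (PUnit.{u + 1} → ℕ) :=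
    { toFun := fun k => Multiplicative.ofAdd fun _ => Multiplicative.toAdd k
      invFun := fun f => Multiplicative.ofAdd (Multiplicative.toAdd f PUnit.unit)
      left_inv := fun _ => rfl
      right_inv := fun _ => rfl
      map_mul' := fun _ _ => rfl }
  exact exists_piNatChart_of_mulEquiv_piNat (e.trans u)

/-- **Charts multiply**: if `M` and `N` have charts `φ : M ↪ ∏_J ℤ≥0`, `ψ : N ↪ ∏_{J'} ℤ≥0`, then
`(m, n) ↦ (φ m, ψ n) ∈ ∏_J ℤ≥0 × ∏_{J'} ℤ≥0 = ∏_{J ⊔ J'} ℤ≥0` is a chart of `M × N` — its image `φ(M) × ψ(N)` is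
group-saturated and perf-dense because both blocks are (for perf-density use the exponent `n₁ n₂`).
[cite: MochizukiFrdI2008, Def. 2.4(i) p.47] -/
theorem exists_piNatChart_prod
    (hM : ∃ (J : Type u) (φ : M →* Multiplicative (J → ℕ)), Injective φ ∧
      IsGroupSaturated (MonoidHom.mrange φ) ∧ ∀ x, x ∈ perfSaturation (MonoidHom.mrange φ))
    (hN : ∃ (J : Type u) (φ : N →* Multiplicative (J → ℕ)), Injective φ ∧
      IsGroupSaturated (MonoidHom.mrange φ) ∧ ∀ x, x ∈ perfSaturation (MonoidHom.mrange φ)) :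
    ∃ (J : Type u) (φ : M × N →* Multiplicative (J → ℕ)), Injective φ ∧
      IsGroupSaturated (MonoidHom.mrange φ) ∧ ∀ x, x ∈ perfSaturation (MonoidHom.mrange φ) := by
  obtain ⟨J, φ, hφ, hφs, hφd⟩ := hM
  obtain ⟨J', ψ, hψ, hψs, hψd⟩ := hN
  -- the two coordinate blocks of `∏_{J ⊔ J'} ℤ≥0`
  let r₁ : Multiplicative (J ⊕ J' → ℕ) →* Multiplicative (J → ℕ) :=
    { toFun := fun f => Multiplicative.ofAdd fun j => Multiplicative.toAdd f (Sum.inl j)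
      map_one' := rfl
      map_mul' := fun _ _ => rfl }
  let r₂ : Multiplicative (J ⊕ J' → ℕ) →* Multiplicative (J' → ℕ) :=
    { toFun := fun f => Multiplicative.ofAdd fun j => Multiplicative.toAdd f (Sum.inr j)
      map_one' := rfl
      map_mul' := fun _ _ => rfl }
  have hext : ∀ f g : Multiplicative (J ⊕ J' → ℕ), r₁ f = r₁ g → r₂ f = r₂ g → f = g := by
    intro f g h₁ h₂
    apply Multiplicative.toAdd.injective
    funext j
    rcases j with j | j
    · exact congrFun (congrArg Multiplicative.toAdd h₁) j
    · exact congrFun (congrArg Multiplicative.toAdd h₂) j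
  -- the chart `(m, n) ↦ (φ m, ψ n)`
  let χ₀ : M × N → Multiplicative (J ⊕ J' → ℕ) := fun x =>
    Multiplicative.ofAdd (Sum.elim (Multiplicative.toAdd (φ x.1)) (Multiplicative.toAdd (ψ x.2)))
  have h₁ : ∀ x, r₁ (χ₀ x) = φ x.1 := fun _ => rfl
  have h₂ : ∀ x, r₂ (χ₀ x) = ψ x.2 := fun _ => rfl
  let χ : M × N →* Multiplicative (J ⊕ J' → ℕ) :=
    { toFun := χ₀
      map_one' := hext _ _ (by simp only [h₁, Prod.fst_one, map_one]) (by simp only [h₂, Prod.snd_one, map_one])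
      map_mul' := fun x y =>
        hext _ _ (by simp only [map_mul, h₁, Prod.fst_mul]) (by simp only [map_mul, h₂, Prod.snd_mul]) }
  have hχ₁ : ∀ x, r₁ (χ x) = φ x.1 := fun _ => rfl
  have hχ₂ : ∀ x, r₂ (χ x) = ψ x.2 := fun _ => rfl
  -- membership in the image, block-wise
  have hmem : ∀ f, f ∈ MonoidHom.mrange χ ↔ r₁ f ∈ MonoidHom.mrange φ ∧ r₂ f ∈ MonoidHom.mrange ψ := by
    intro f
    constructor
    · rintro ⟨x, rfl⟩
      exact ⟨⟨x.1, (hχ₁ x).symm⟩, ⟨x.2, (hχ₂ x).symm⟩⟩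
    · rintro ⟨⟨m, hm⟩, ⟨n, hn⟩⟩
      exact ⟨(m, n), hext _ _ (by rw [hχ₁, hm]) (by rw [hχ₂, hn])⟩
  refine ⟨J ⊕ J', χ, fun x y h => ?_, ?_, fun f => ?_⟩
  · -- injective
    exact Prod.ext (hφ (by rw [← hχ₁, ← hχ₁, h])) (hψ (by rw [← hχ₂, ← hχ₂, h]))
  · -- group-saturated
    rw [isGroupSaturated_iff']
    intro q a ha b hb hqb
    rw [hmem] at ha hb ⊢
    exact ⟨(isGroupSaturated_iff' _).mp hφs (r₁ q) _ ha.1 _ hb.1 (by rw [← map_mul, hqb]),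
      (isGroupSaturated_iff' _).mp hψs (r₂ q) _ ha.2 _ hb.2 (by rw [← map_mul, hqb])⟩
  · -- perf-dense
    obtain ⟨n₁, hn₁⟩ := (mem_perfSaturation_iff _ (r₁ f)).mp (hφd (r₁ f))
    obtain ⟨n₂, hn₂⟩ := (mem_perfSaturation_iff _ (r₂ f)).mp (hψd (r₂ f))
    refine (mem_perfSaturation_iff _ f).mpr ⟨n₁ * n₂, (hmem _).mpr ⟨?_, ?_⟩⟩
    · rw [map_pow, PNat.mul_coe, pow_mul]
      exact Submonoid.pow_mem _ hn₁ _
    · rw [map_pow, PNat.mul_coe, mul_comm, pow_mul]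
      exact Submonoid.pow_mem _ hn₂ _

/-- **Products of monoids with charts are weakly perf-factorial with cofinal perfection.**
[cite: MochizukiFrdI2008, Def. 2.4(i) p.47] -/
theorem IsPerfFactorialCof.prod_of_exists_piNatChart
    (hM : ∃ (J : Type u) (φ : M →* Multiplicative (J → ℕ)), Injective φ ∧
      IsGroupSaturated (MonoidHom.mrange φ) ∧ ∀ x, x ∈ perfSaturation (MonoidHom.mrange φ))
    (hN : ∃ (J : Type u) (φ : N →* Multiplicative (J → ℕ)), Injective φ ∧
      IsGroupSaturated (MonoidHom.mrange φ) ∧ ∀ x, x ∈ perfSaturation (MonoidHom.mrange φ)) :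
    IsPerfFactorialCof (M × N) :=
  IsPerfFactorialCof.of_exists_piNatChart (exists_piNatChart_prod hM hN)

/-- In particular **`M × N` is weakly perf-factorial with cofinal perfection for `M` with a chart and `N`
`ℤ`-monoprime** (`N ≅ ℤ≥0`). [cite: MochizukiFrdI2008, Def. 2.4(i) p.47] -/
theorem IsPerfFactorialCof.prod_of_exists_piNatChart_of_isZMonoprime
    (hM : ∃ (J : Type u) (φ : M →* Multiplicative (J → ℕ)), Injective φ ∧
      IsGroupSaturated (MonoidHom.mrange φ) ∧ ∀ x, x ∈ perfSaturation (MonoidHom.mrange φ))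
    (hN : IsZMonoprime N) : IsPerfFactorialCof (M × N) :=
  IsPerfFactorialCof.prod_of_exists_piNatChart hM (exists_piNatChart_of_isZMonoprime hN)

/-- `ℤ`-monoprime times `ℤ`-monoprime (`ℤ≥0 × ℤ≥0`) is weakly perf-factorial with cofinal perfection.
[cite: MochizukiFrdI2008, Def. 2.4(i) p.47] -/
theorem IsPerfFactorialCof.prod_of_isZMonoprime (hM : IsZMonoprime M) (hN : IsZMonoprime N) :
    IsPerfFactorialCof (M × N) :=
  IsPerfFactorialCof.prod_of_exists_piNatChart (exists_piNatChart_of_isZMonoprime hM)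
    (exists_piNatChart_of_isZMonoprime hN)

end Charts

/-! ### The constructed `Φ₀`-pieces `Φ₀(S) = Hom_G(S, Div⁺(Z^log_∞))` have charts; products -/

namespace LogDivisorModel.GaloisAction

variable {Z : LogDivisorModel.{u}} {G : Type u} [Group G] (A : Z.GaloisAction G) (S : Action (Type u) G)

/-- **`Φ₀(S) = Hom_G(S, Div⁺(Z^log_∞))` has a chart**: it is (abc-iut-w6-d057/d058) the monoid of `Γ`-invariant maps
`S → DIV⁺` with Cartier values, a group-saturated (`Div` is a subgroup) and perf-dense (Prop. 3.2 (i)) submonoid of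
`Maps(S, DIV⁺)^Γ ≅ (∏_{S × (Cusp ⊔ Comp)} ℤ≥0)^{Γ₀} ≅ ∏_{orbits} ℤ≥0` (Rmk. 3.3.1).
[cite: MochizukiEtTh2009, Prop 3.4 p.74] -/
theorem exists_piNatChart_phiZero :
    ∃ (J : Type u) (φ : ↥(A.phiZero S) →* Multiplicative (J → ℕ)), Injective φ ∧
      IsGroupSaturated (MonoidHom.mrange φ) ∧ ∀ x, x ∈ perfSaturation (MonoidHom.mrange φ) := by
  classical
  obtain ⟨Γ, ⟨e⟩⟩ := exists_phiZero_mulEquiv A S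
  obtain ⟨Γ₀, ⟨e₀⟩⟩ := exists_fixedPoints_maps_congr (Z := Z) S Γ
  obtain ⟨Q, ⟨e₁⟩⟩ := PiNat.exists_fixedPoints_mulEquiv Γ₀
  exact exists_piNatChart_of_mulEquiv e
    (exists_piNatChart_of_submonoid (e₀.trans e₁) (isGroupSaturated_cartier_fixedPoints_maps (Z := Z) S Γ)
      (mem_perfSaturation_cartier_fixedPoints_maps (Z := Z) S Γ))

/-- **`Φ₀(S) × N` is weakly perf-factorial with cofinal perfection for every `ℤ`-monoprime `N`** — the `hpf`
hypothesis of `RealifiedDivisorMonoids.ofRlfZWeak` (Def. 3.6 (i)) for a divisor monoid whose value at an object is the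
direct sum of a constructed Def. 3.3 (iii) piece and a value monoid `ord(𝒪^▷_K) ≅ ℤ≥0` ([FrdII] Ex. 1.1 (i)): the
shape of GA-02's `ArithThetaTower.divisorMonoidsOf` (RULINGS #334). [cite: MochizukiEtTh2009, Prop 3.4 p.74] -/
theorem isPerfFactorialCof_phiZero_prod {N : Type u} [CommMonoid N] (hN : IsZMonoprime N) :
    IsPerfFactorialCof (↥(A.phiZero S) × N) :=
  IsPerfFactorialCof.prod_of_exists_piNatChart_of_isZMonoprime (exists_piNatChart_phiZero A S) hN

/-- The same with the factors in the other order: `N × Φ₀(S)`. [cite: MochizukiEtTh2009, Prop 3.4 p.74] -/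
theorem isPerfFactorialCof_prod_phiZero {N : Type u} [CommMonoid N] (hN : IsZMonoprime N) :
    IsPerfFactorialCof (N × ↥(A.phiZero S)) :=
  IsPerfFactorialCof.prod_of_exists_piNatChart (exists_piNatChart_of_isZMonoprime hN)
    (exists_piNatChart_phiZero A S)

/-- `Φ₀(S) × Φ₀'(S')` (two constructed pieces, possibly for different models / groups) is weakly perf-factorial with
cofinal perfection. [cite: MochizukiEtTh2009, Prop 3.4 p.74] -/
theorem isPerfFactorialCof_phiZero_prod_phiZero {Z' : LogDivisorModel.{u}} {G' : Type u} [Group G']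
    (A' : Z'.GaloisAction G') (S' : Action (Type u) G') :
    IsPerfFactorialCof (↥(A.phiZero S) × ↥(A'.phiZero S')) :=
  IsPerfFactorialCof.prod_of_exists_piNatChart (exists_piNatChart_phiZero A S) (exists_piNatChart_phiZero A' S')

/-- Every prime component of `Φ₀(S) × N` (`N` `ℤ`-monoprime) is `ℤ`-monoprime. [cite: MochizukiEtTh2009, Rmk 3.3.1 p.73] -/
theorem isZMonoprime_submonoid_primes_phiZero_prod {N : Type u} [CommMonoid N] (hN : IsZMonoprime N)
    (𝔭 : Primes (↥(A.phiZero S) × N)) : IsZMonoprime ↥𝔭.submonoid :=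
  isZMonoprime_submonoid_primes_of_exists_piNatChart
    (exists_piNatChart_prod (exists_piNatChart_phiZero A S) (exists_piNatChart_of_isZMonoprime hN)) 𝔭

/-- **[EtTh] Prop. 3.4 (i), first clause, in the weak vocabulary of record**, for the product pieces:
`treeMonoidVocabWeak.IsPerfFactorial (Φ₀(S) × N)` for `N` `ℤ`-monoprime. [cite: MochizukiEtTh2009, Prop 3.4 p.74] -/
theorem prop34_i_phiZero_prod {N : Type u} [CommMonoid N] (hN : IsZMonoprime N) :
    treeMonoidVocabWeak.IsPerfFactorial (↥(A.phiZero S) × N) :=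
  (treeMonoidVocabWeak_isPerfFactorial _).mpr (isPerfFactorialCof_phiZero_prod A S hN)

end LogDivisorModel.GaloisAction

end Literature.AnabelianGeometry.EtaleTheta

end
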